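import Mathlib.Logic.Basic
import HarnessLib

/-!
# Venture HSemireg — NET PROPAGATION: one axis partner on a product layer gives a net (and ζ keeps partners off the Weil lines)

Companion to `FibrePartition.lean` (THEOREM F, k = 161) and `AdditiveNetClassDeath.lean` (THEOREM H-NET, k = 251) —
cell pub-hsemireg, seat p2 gen 14, note `p2/wlaws/NET-REDUCTION-p2g14.md` §2b (LEMMA) and §2d (PROPOSITION, THE CHAIN).

SETTING (there). Fix a sloped slot-3 line `m`; the `m`-layer of a reduced flat-LEGO configuration `Z` consists of the
triples `(x, y, m) ∈ Z`; its WEIL part is the set of pairs of SLOPED lines `(ℓ, L)` with `(ℓ, L, m) ∈ Z`; A-pads `(p,S,m)`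
and A′-pads `(S,q,m)` give the feet.  The catalogue facts used are (X·A) ∕ (X·A′) («a crossed pair of triples over `m`
through `(p,q)` plus one pad gives the other pad», `FIBRE-PARTITION-p2g12.md` §1, = hypotheses `crossA`, `crossA'` of
`FibrePartition.lean`) and ζ («two triples over `m` sharing their slot-2 line exclude the A-pad at a crossing of their
slot-1 lines», and its mirror; `WEIL-PROLIFERATION-p2g8.md` §2).  (PW) says the Weil part is a full product.

THIS FILE is the kernel form of the two incidence steps of the note's chain
«THEOREM H ⟸ THEOREM F + (PW) + (MIX∅)», as abstract bookkeeping over points `P₁, P₂`, lines `L₁, L₂`, incidence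
relations, and the `Z`-data of ONE layer (`T x y` = «(x,y,m) ∈ Z», `A p` = «(p,S,m) ∈ Z», `A' q` = «(S,q,m) ∈ Z»;
`sl₁`, `sl₂` = «sloped»):
* `partner_off_weil_lines` (LEMMA of §2b): under (PW) and ζ, at a doubly-footed curve `p × q × m` of a Weil triple
  `(ℓ, L, m)` every other line `x ∋ p`, `y ∋ q` — so both lines of the crossed partner triple — lies on no Weil pair
  of the layer; in particular the partner is not Weil;
* `net_of_axis_partner` (PROPOSITION of §2d): under (PW) and (X·A)∕(X·A′), if ONE Weil triple `(ℓ₀, L₀, m)` has a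
  doubly-footed curve `p₀ × q₀ × m` with a partner `(x₀, y₀, m) ∈ Z` whose lines are not sloped and meet every sloped
  line (axis lines do), then `(x₀, y₀)` is a NET PARTNER: every Weil line `ℓ` of the layer meets `x₀` in an A-foot and
  every Weil line `L` meets `y₀` in an A′-foot — the hypothesis (NET) of `AdditiveNetClassDeath.lean`.
What the kernel certifies: the LOGIC of these two steps; what it does not: that a given support satisfies (PW), has an
axis partner, or satisfies the catalogue facts (note §2–§3: censuses).

HONEST FRAMING. Finite incidence bookkeeping; no variety, cycle, cohomology class or semiregularity map occurs; nothing
here bears on HC ∕ HC_CM ∕ HC_AV.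
-/

namespace Summit.Ventures.HSemireg
namespace NetPropagation

variable {P₁ P₂ L₁ L₂ : Type*}

/-- **LEMMA (product Weil part + ζ ⇒ partners lie off the Weil lines).**  Layer data: `T x y` («(x,y,m) ∈ Z»),
`A p`, `A' q` (pads of `m` at `p`, `q`), incidences `on₁`, `on₂`, slopedness `sl₁`, `sl₂`; (PW) `product`; ζ in both
point slots.  If `(ℓ,L,m)` is Weil and `p ∈ ℓ`, `q ∈ L` carry both pads, then ANY other lines `x ∋ p` (`x ≠ ℓ`) and
`y ∋ q` (`y ≠ L`) — in particular the two lines of the crossed partner triple at `p × q × m` — lie on no Weil pair of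
the layer (the partner's membership in `Z` is not even needed). -/
theorem partner_off_weil_lines (T : L₁ → L₂ → Prop) (A : P₁ → Prop) (A' : P₂ → Prop)
    (on₁ : P₁ → L₁ → Prop) (on₂ : P₂ → L₂ → Prop) (sl₁ : L₁ → Prop) (sl₂ : L₂ → Prop)
    (product : ∀ ℓ L ℓ' L', sl₁ ℓ → sl₂ L → sl₁ ℓ' → sl₂ L' → T ℓ L → T ℓ' L' → T ℓ L')
    (zeta₁ : ∀ ℓ ℓ' L p, T ℓ L → T ℓ' L → ℓ ≠ ℓ' → on₁ p ℓ → on₁ p ℓ' → ¬ A p)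
    (zeta₂ : ∀ ℓ L L' q, T ℓ L → T ℓ L' → L ≠ L' → on₂ q L → on₂ q L' → ¬ A' q)
    {ℓ : L₁} {L : L₂} {x : L₁} {y : L₂} {p : P₁} {q : P₂}
    (hℓ : sl₁ ℓ) (hL : sl₂ L) (hT : T ℓ L) (hxℓ : x ≠ ℓ) (hyL : y ≠ L)
    (hpℓ : on₁ p ℓ) (hpx : on₁ p x) (hqL : on₂ q L) (hqy : on₂ q y) (hA : A p) (hA' : A' q) :
    (¬ ∃ L', sl₁ x ∧ sl₂ L' ∧ T x L') ∧ (¬ ∃ ℓ', sl₂ y ∧ sl₁ ℓ' ∧ T ℓ' y) := by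
  refine ⟨?_, ?_⟩
  · rintro ⟨L', hslx, hslL', hxL'⟩
    -- (PW): (x, L, m) ∈ Z; then ζ at p ∈ ℓ ∩ x kills the A-pad at p
    have hxL : T x L := product x L' ℓ L hslx hslL' hℓ hL hxL' hT
    exact zeta₁ ℓ x L p hT hxL (Ne.symm hxℓ) hpℓ hpx hA
  · rintro ⟨ℓ', hsly, hslℓ', hℓ'y⟩
    have hℓy : T ℓ y := product ℓ L ℓ' y hℓ hL hslℓ' hsly hT hℓ'y
    exact zeta₂ ℓ L y q hT hℓy (Ne.symm hyL) hqL hqy hA'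

/-- **PROPOSITION (NET PROPAGATION).**  Under (PW) `product` and the crossed-pair facts (X·A) `crossA`, (X·A′)
`crossA'`: if one Weil triple `(ℓ₀, L₀, m)` has feet `p₀ ∈ ℓ₀`, `q₀ ∈ L₀` (both pads) and a partner `(x₀, y₀, m) ∈ Z`
through `(p₀, q₀)` whose lines are NOT sloped and meet every sloped line of their slot (`meet₁`, `meet₂` — true for
axis lines), then every Weil triple `(ℓ, L, m)` of the layer has an A-foot on `x₀ ∩ ℓ` and an A′-foot on `y₀ ∩ L`:
`(x₀, y₀)` is a net partner of the layer. -/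
theorem net_of_axis_partner (T : L₁ → L₂ → Prop) (A : P₁ → Prop) (A' : P₂ → Prop)
    (on₁ : P₁ → L₁ → Prop) (on₂ : P₂ → L₂ → Prop) (sl₁ : L₁ → Prop) (sl₂ : L₂ → Prop)
    (product : ∀ ℓ L ℓ' L', sl₁ ℓ → sl₂ L → sl₁ ℓ' → sl₂ L' → T ℓ L → T ℓ' L' → T ℓ L')
    (crossA : ∀ x x' y y' p q, T x y → T x' y' → x ≠ x' → y ≠ y' →
      on₁ p x → on₁ p x' → on₂ q y → on₂ q y' → A p → A' q)
    (crossA' : ∀ x x' y y' p q, T x y → T x' y' → x ≠ x' → y ≠ y' →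
      on₁ p x → on₁ p x' → on₂ q y → on₂ q y' → A' q → A p)
    {ℓ₀ x₀ : L₁} {L₀ y₀ : L₂} {p₀ : P₁} {q₀ : P₂}
    (hℓ₀ : sl₁ ℓ₀) (hL₀ : sl₂ L₀) (hT₀ : T ℓ₀ L₀) (hR : T x₀ y₀) (hx₀ : ¬ sl₁ x₀) (hy₀ : ¬ sl₂ y₀)
    (hp₀ℓ : on₁ p₀ ℓ₀) (hp₀x : on₁ p₀ x₀) (hq₀L : on₂ q₀ L₀) (hq₀y : on₂ q₀ y₀) (hA₀ : A p₀) (hA'₀ : A' q₀)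
    (meet₁ : ∀ ℓ, sl₁ ℓ → ∃ p, on₁ p ℓ ∧ on₁ p x₀) (meet₂ : ∀ L, sl₂ L → ∃ q, on₂ q L ∧ on₂ q y₀)
    {ℓ : L₁} {L : L₂} (hℓ : sl₁ ℓ) (hL : sl₂ L) (hT : T ℓ L) :
    (∃ p, on₁ p ℓ ∧ on₁ p x₀ ∧ A p) ∧ (∃ q, on₂ q L ∧ on₂ q y₀ ∧ A' q) := by
  have hxℓ : ℓ ≠ x₀ := fun h => hx₀ (h ▸ hℓ)
  have hyL : L ≠ y₀ := fun h => hy₀ (h ▸ hL)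
  have hℓ₀x : ℓ₀ ≠ x₀ := fun h => hx₀ (h ▸ hℓ₀)
  have hL₀y : L₀ ≠ y₀ := fun h => hy₀ (h ▸ hL₀)
  refine ⟨?_, ?_⟩
  · -- (PW): (ℓ, L₀, m) ∈ Z; at p × q₀ × m the triples (ℓ,L₀,m), (x₀,y₀,m) are crossed; (X·A′) with the A′-pad at q₀
    obtain ⟨p, hpℓ, hpx⟩ := meet₁ ℓ hℓ
    have hTℓ : T ℓ L₀ := product ℓ L ℓ₀ L₀ hℓ hL hℓ₀ hL₀ hT hT₀
    exact ⟨p, hpℓ, hpx, crossA' ℓ x₀ L₀ y₀ p q₀ hTℓ hR hxℓ hL₀y hpℓ hpx hq₀L hq₀y hA'₀⟩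
  · obtain ⟨q, hqL, hqy⟩ := meet₂ L hL
    have hTL : T ℓ₀ L := product ℓ₀ L₀ ℓ L hℓ₀ hL₀ hℓ hL hT₀ hT
    exact ⟨q, hqL, hqy, crossA ℓ₀ x₀ L y₀ p₀ q hTL hR hℓ₀x hyL hp₀ℓ hp₀x hqL hqy hA₀⟩

end NetPropagation
end Summit.Ventures.HSemireg
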